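import Literature.NumberTheory.EllipticCurves.Fisher2012.HesseFamilyFiveIndClosedForms
import Literature.NumberTheory.EllipticCurves.QuadraticTwist
import HarnessLib

/-!
# Route `SignedLowerHalves`, crux `KobayashiMainConjectureSmallImage` (item stmt-BirchSwinnertonDyer-19002) —
# «L4-DIHEDRAL» kernel records @ 5: the CM SHADOW of the three newform-partnered non-surjective `a_5 = 0` pairs, certified as a
# SELF-TWIST `5`-CONGRUENCE `E[5] ≅ E^{(d_K)}[5]` in Fisher's INDIRECT quintic family (cell `bsd-ssimc`, seat `bsd-ssimc-k3-c4`
# gen 10; `--supports stmt-BirchSwinnertonDyer-19002 --as helper`)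

HONEST FRAMING: Kobayashi's signed main conjecture at a non-surjective (normaliser-of-non-split-Cartan) image is OPEN as a
class statement; item 4 stays OPEN; nothing here is booked; BSD is not proved by any of this. PER-PAIR STRUCTURE certificates,
CONDITIONAL on ONE published named fact `hF' : thm58_fiveCongruent_hessePencilInd` (Fisher, Math. Ann. 356 (2013) Thm. 5.8 — the
binder of the cell's accepted part E, p505593).

WHAT IS CERTIFIED. For `249777l1 @ 5`, `431433o1 @ 5` (`K = ℚ(√−87)`, `h_K = 6`) and `269059r1 @ 5` (`K = ℚ(√−7)`, `h_K = 1`, but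
`χ̄/ψ̄_A` is not quadratic for the CM curves `A` of `K`: no CM elliptic-curve partner over `ℚ`, re-tested in kit j272679 against
every class-number-one CM order of `K` and all quadratic twists supported on `{−1,2,3,5} ∪ primes(N_E)`): a `Γ_ℚ`-equivariant
isomorphism `E^{(d_K)}[5] ≃ E[5]` with `E^{(d_K)} = W.quadraticTwist d_K` (tree model: `c₄ = d²c₄`, `c₆ = d³c₆`). As in the
companion file `…SelfTwistRecordsThree.lean`, this is `ρ̄_{E,5} ≅ ρ̄_{E,5} ⊗ ε_K`, i.e. (given irreducibility) `ρ̄_{E,5}` is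
induced from `K` — the CM shadow consumed by the newform road «L4-JLK» (memo k3c4-MEMO-9); the induced form is NOT asserted here.

MECHANISM: at `p = 5 ≡ 1 (mod 4)` the `𝔽_5`-rational intertwiner `ρ̄ ⊗ ε_K → ρ̄` of a normaliser-of-NON-split-Cartan
representation has NON-square determinant, so the twist lies in the INDIRECT (`r = 2`) family `Y_E^{(2)}(5)` — exactly what the
exact projective search finds (kit j272679: an affine rational point on the indirect family; on the direct family `X_E(5)` the
only rational point with `j = j(E)` is `(1:0)`, the curve `E` itself, twist class `d_K`). Kernel step:
`fiveCongruent_of_hesseIndCertificate hF'` with `G := W.quadraticTwist d` (`4·𝔠₄′(λ,μ) = 9u⁴·d²c₄`, `8·𝔠₆′(λ,μ) = 27u⁶·d³c₆`,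
closed forms `eval_hesseC4ind` / `eval_hesseC6ind`, `norm_num`).

Kato-side by-product recorded in the memo (not used here): for these three pairs Kato 2004 Thm 15.2 (b) HOLDS (`5 ∤ w(H_K)·h_K`,
no additive prime of `E` has a prime of `K` above it of norm `≡ 1 (mod 5)`), unlike every window pair at `p = 3`.

PARTITION (cell bsd-ssimc): X7 (A7) × item 4's three newform-partnered pairs @ 5 — types-the-object-of (the CM shadow);
closes NONE; 0 census moves.

References: [Fisher2013QuinticTwists] Thm. 5.8, Lemma 5.6; [Fisher2012Hessian] §8; [SilvermanAEC2009] X.5 Cor. 5.4;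
[Cremona2006] Table 1. Memo: `HOME/k3c4-MEMO-9.md` (cell bsd-ssimc).
-/

set_option autoImplicit false
set_option linter.dupNamespace false

noncomputable section

open scoped Classical

open WeierstrassCurve Literature.NumberTheory.EllipticCurves Literature.NumberTheory.EllipticCurves.Fisher2012

namespace Summit.BirchSwinnertonDyer.BirchSwinnertonDyer.Theorems

/-! ### §1 The self-twist form of the indirect quintic certificate -/

/-- **Self-twist `5`-congruence from an indirect quintic Hesse certificate.** For an elliptic curve `W/ℚ`, `d ≠ 0`, `l m u : ℚ`,
`u ≠ 0`, with `4·𝔠₄′(l,m) = 9u⁴·(d²c₄(W))` and `8·𝔠₆′(l,m) = 27u⁶·(d³c₆(W))` (covariants of Fisher's INDIRECT family of `W`):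
`W^d[5] ≅ W[5]` as `Γ_ℚ`-modules for `W^d = W.quadraticTwist d` — `fiveCongruent_of_hesseIndCertificate` with
`G := W.quadraticTwist d` (elliptic by `isElliptic_quadraticTwist`), CONDITIONAL on the named fact `hF'` (Fisher 2013 Thm. 5.8).
[cite: Fisher2013QuinticTwists, Thm. 5.8] [cite: SilvermanAEC2009, X.5 Cor. 5.4] -/
theorem fiveCongruent_quadraticTwist_of_hesseIndCertificate (hF' : thm58_fiveCongruent_hessePencilInd)
    (W : WeierstrassCurve ℚ) [W.IsElliptic] (d l m u : ℚ) (hd : d ≠ 0) (hu : u ≠ 0)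
    (h4 : 4 * MvPolynomial.eval ![l, m] (hesseC4ind W.c₄ W.c₆) = 9 * (u ^ 4 * (d ^ 2 * W.c₄)))
    (h6 : 8 * MvPolynomial.eval ![l, m] (hesseC6ind W.c₄ W.c₆) = 27 * (u ^ 6 * (d ^ 3 * W.c₆))) :
    ∃ e : geomTorsion (W.quadraticTwist d) (5 : ℤ) ≃+ geomTorsion W (5 : ℤ),
      ∀ (σ : Field.absoluteGaloisGroup ℚ) (Q : geomTorsion (W.quadraticTwist d) (5 : ℤ)), e (σ • Q) = σ • e Q := by
  haveI : (W.quadraticTwist d).IsElliptic := isElliptic_quadraticTwist W hd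
  refine fiveCongruent_of_hesseIndCertificate hF' W (W.quadraticTwist d) l m u hu ?_ ?_
  · rw [quadraticTwist_c₄]; exact h4
  · rw [quadraticTwist_c₆]; exact h6

/-! ### §2 The records: `E[5] ≅ E^{(d_K)}[5]` for the three newform-partnered item-4 pairs @ 5 -/

/-- **`249777l1[5] ≅ 249777l1^{(-87)}[5]` (Γ_ℚ-equivariantly, modulo `hF'`): the CM shadow of `249777l1 @ 5` is `K = ℚ(√−87)` (`d_K = -87`,
`h_K = 6`, `5` inert).** Cremona model `[0, 0, 1, -151455690, -716756974018]` (`N = 249777 = 3^3 · 11 · 29^2`, `r_an = 0`; X7, `a_5 = 0`, image `5Nn`); the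
twist `W.quadraticTwist (-87)` is `ℚ`-isomorphic to the curve of conductor `249777` with minimal model `[0, 0, 1, -20010, 1088464]` (kit j272679).
KERNEL certificate: `E^{(-87)}` ≅ the member `(-89784 : 1)` of Fisher's INDIRECT family `Y_E^{(2)}(5)`, `u = 33172550239098081456970335602583552`
(`fiveCongruent_quadraticTwist_of_hesseIndCertificate`, `norm_num`). Dihedral check (not used by the kernel): `a_ℓ ≡ 0 (mod 5)` at all
277 good `K`-inert `ℓ ≤ 4000`. CONDITIONAL on `hF'` (Fisher 2013 Thm. 5.8, PUBLISHED). Structure only; item 4 stays OPEN;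
nothing booked; BSD is not proved by any of this.
[cite: Fisher2013QuinticTwists, Thm. 5.8] [cite: Cremona2006, Table 1 (Cremona label 249777l1)] -/
theorem selfTwistFive_c249777l1 (hF' : thm58_fiveCongruent_hessePencilInd) (W : WeierstrassCurve ℚ) [W.IsElliptic]
    (hW : W = ⟨0, 0, 1, -151455690, -716756974018⟩) :
    ∃ e : geomTorsion (W.quadraticTwist (-87 : ℚ)) (5 : ℤ) ≃+ geomTorsion W (5 : ℤ),
      ∀ (σ : Field.absoluteGaloisGroup ℚ) (Q : geomTorsion (W.quadraticTwist (-87 : ℚ)) (5 : ℤ)), e (σ • Q) = σ • e Q := by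
  have hc4 : W.c₄ = (7269873120 : ℚ) := by
    subst hW; norm_num [WeierstrassCurve.c₄, WeierstrassCurve.b₂, WeierstrassCurve.b₄]
  have hc6 : W.c₆ = (619278025551336 : ℚ) := by
    subst hW; norm_num [WeierstrassCurve.c₆, WeierstrassCurve.b₂, WeierstrassCurve.b₄, WeierstrassCurve.b₆]
  exact fiveCongruent_quadraticTwist_of_hesseIndCertificate hF' W (-87 : ℚ) (-89784 : ℚ) (1 : ℚ) (33172550239098081456970335602583552 : ℚ)
    (by norm_num) (by norm_num) (by rw [hc4, hc6, eval_hesseC4ind]; norm_num) (by rw [hc4, hc6, eval_hesseC6ind]; norm_num)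

/-- **`269059r1[5] ≅ 269059r1^{(-7)}[5]` (Γ_ℚ-equivariantly, modulo `hF'`): the CM shadow of `269059r1 @ 5` is `K = ℚ(√−7)` (`d_K = -7`,
`h_K = 1`, `5` inert).** Cremona model `[0, 0, 1, -16163770, -25012514116]` (`N = 269059 = 7^2 · 17^2 · 19`, `r_an = 0`; X7, `a_5 = 0`, image `5Nn`); the
twist `W.quadraticTwist (-7)` is `ℚ`-isomorphic to the curve of conductor `269059` with minimal model `[0, 0, 1, -792024730, 8579292341702]` (kit j272679).
KERNEL certificate: `E^{(-7)}` ≅ the member `(-27064 : 1)` of Fisher's INDIRECT family `Y_E^{(2)}(5)`, `u = 31269832072551645116139595776`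
(`fiveCongruent_quadraticTwist_of_hesseIndCertificate`, `norm_num`). Dihedral check (not used by the kernel): `a_ℓ ≡ 0 (mod 5)` at all
275 good `K`-inert `ℓ ≤ 4000`. CONDITIONAL on `hF'` (Fisher 2013 Thm. 5.8, PUBLISHED). Structure only; item 4 stays OPEN;
nothing booked; BSD is not proved by any of this.
[cite: Fisher2013QuinticTwists, Thm. 5.8] [cite: Cremona2006, Table 1 (Cremona label 269059r1)] -/
theorem selfTwistFive_c269059r1 (hF' : thm58_fiveCongruent_hessePencilInd) (W : WeierstrassCurve ℚ) [W.IsElliptic]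
    (hW : W = ⟨0, 0, 1, -16163770, -25012514116⟩) :
    ∃ e : geomTorsion (W.quadraticTwist (-7 : ℚ)) (5 : ℤ) ≃+ geomTorsion W (5 : ℤ),
      ∀ (σ : Field.absoluteGaloisGroup ℚ) (Q : geomTorsion (W.quadraticTwist (-7 : ℚ)) (5 : ℤ)), e (σ • Q) = σ • e Q := by
  have hc4 : W.c₄ = (775860960 : ℚ) := by
    subst hW; norm_num [WeierstrassCurve.c₄, WeierstrassCurve.b₂, WeierstrassCurve.b₄]
  have hc6 : W.c₆ = (21610812196008 : ℚ) := by
    subst hW; norm_num [WeierstrassCurve.c₆, WeierstrassCurve.b₂, WeierstrassCurve.b₄, WeierstrassCurve.b₆]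
  exact fiveCongruent_quadraticTwist_of_hesseIndCertificate hF' W (-7 : ℚ) (-27064 : ℚ) (1 : ℚ) (31269832072551645116139595776 : ℚ)
    (by norm_num) (by norm_num) (by rw [hc4, hc6, eval_hesseC4ind]; norm_num) (by rw [hc4, hc6, eval_hesseC6ind]; norm_num)

/-- **`431433o1[5] ≅ 431433o1^{(-87)}[5]` (Γ_ℚ-equivariantly, modulo `hF'`): the CM shadow of `431433o1 @ 5` is `K = ℚ(√−87)` (`d_K = -87`,
`h_K = 6`, `5` inert).** Cremona model `[1, -1, 0, -560307, 161571262]` (`N = 431433 = 3^3 · 19 · 29^2`, `r_an = 0`; X7, `a_5 = 0`, image `5Nn`); the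
twist `W.quadraticTwist (-87)` is `ℚ`-isomorphic to the curve of conductor `431433` with minimal model `[1, -1, 0, -4240965102, -106301859518827]` (kit j272679).
KERNEL certificate: `E^{(-87)}` ≅ the member `(15503/3 : 1)` of Fisher's INDIRECT family `Y_E^{(2)}(5)`, `u = 11652361189866143744/27`
(`fiveCongruent_quadraticTwist_of_hesseIndCertificate`, `norm_num`). Dihedral check (not used by the kernel): `a_ℓ ≡ 0 (mod 5)` at all
276 good `K`-inert `ℓ ≤ 4000`. CONDITIONAL on `hF'` (Fisher 2013 Thm. 5.8, PUBLISHED). Structure only; item 4 stays OPEN;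
nothing booked; BSD is not proved by any of this.
[cite: Fisher2013QuinticTwists, Thm. 5.8] [cite: Cremona2006, Table 1 (Cremona label 431433o1)] -/
theorem selfTwistFive_c431433o1 (hF' : thm58_fiveCongruent_hessePencilInd) (W : WeierstrassCurve ℚ) [W.IsElliptic]
    (hW : W = ⟨1, -1, 0, -560307, 161571262⟩) :
    ∃ e : geomTorsion (W.quadraticTwist (-87 : ℚ)) (5 : ℤ) ≃+ geomTorsion W (5 : ℤ),
      ∀ (σ : Field.absoluteGaloisGroup ℚ) (Q : geomTorsion (W.quadraticTwist (-87 : ℚ)) (5 : ℤ)), e (σ • Q) = σ • e Q := by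
  have hc4 : W.c₄ = (26894745 : ℚ) := by
    subst hW; norm_num [WeierstrassCurve.c₄, WeierstrassCurve.b₂, WeierstrassCurve.b₄]
  have hc6 : W.c₆ = (-139476544029 : ℚ) := by
    subst hW; norm_num [WeierstrassCurve.c₆, WeierstrassCurve.b₂, WeierstrassCurve.b₄, WeierstrassCurve.b₆]
  exact fiveCongruent_quadraticTwist_of_hesseIndCertificate hF' W (-87 : ℚ) ((15503 : ℚ) / 3) (1 : ℚ) ((11652361189866143744 : ℚ) / 27)
    (by norm_num) (by norm_num) (by rw [hc4, hc6, eval_hesseC4ind]; norm_num) (by rw [hc4, hc6, eval_hesseC6ind]; norm_num)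

end Summit.BirchSwinnertonDyer.BirchSwinnertonDyer.Theorems

end
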